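import Summits.BirchSwinnertonDyer.BirchSwinnertonDyer.Theorems.ManinLocalTwoThreeManinPrimeToAdditiveFiveLeHorocyclicBottom
import Summits.BirchSwinnertonDyer.BirchSwinnertonDyer.Theorems.ManinLocalTwoThreeManinPrimeToAdditiveFiveLeOrdinaryCornerNotBottomOfOrdinaryTwistLaws
import HarnessLib

/-!
# Route `ManinLocalTwoThree`, residual crux C5 `ManinPrimeToAdditiveFiveLe` (stmt-BirchSwinnertonDyer-22969),
# registered stub `stub_ord57` (stmt-27552), line «horocyclic-orientation», part 3/3: **its support stub
# `stub_notBottom_of_horocyclic57 : OrdinaryCornerDeepUnstarredHorocyclic → OrdinaryCornerDeepUnstarredNotBottom`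
# (K18b″, stmt-27662, BY NAME)**

Width seat bsd-line-ml23-c5-p1-w3 (gen 3). The line «horocyclic-orientation» (bsd-idea-8 g6, publish-only; the line
of record stays `upper_anchor`) replaces `stub_ord57`'s sub-item K18b″ `OrdinaryCornerDeepUnstarredNotBottom`
(stmt-27662: on the reducible potentially-ordinary corner rows `(5; v₅Δ = 3)`, `(7; v₇Δ ∈ {2,4})` the lattice-optimal
deep form is never in Edixhoven's case 1) by its crux H57 `OrdinaryCornerDeepUnstarredHorocyclic` («some horocyclic
`k`-th difference `Δ^k_{1/p}{∞, A/C}_{f_W}`, `A ≡ ±1 (p)`, `N ∣ C`, is not in `p·Λ_{f_W}`») plus the support stub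
proved HERE: `ordinaryCornerDeepUnstarredNotBottom_of_horocyclicWitnesses` — K18b″ BY NAME from H57, the latter
spelled out verbatim (its `def` lives in the Cruxes skeleton `Lines/horocyclic_orientation.lean`, which is not
importable; the skeleton's stub then closes by `fun h ↦ ordinaryCornerDeepUnstarredNotBottom_of_horocyclicWitnesses h`,
kernel-checked in this seat's scratch file). Proof: part 2/3 `horocyclicDifference_mem_of_bottom` at the quadratic
primitive character, which has the Legendre values (`dirichletCharacter_eq_quadraticChar_of_isQuadratic_of_isPrimitive`)
and a non-zero Gauss sum (`gaussSum_stdAddChar_ne_zero_of_isPrimitive`).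

HONEST STATUS. Unconditional, but only the TRANSFER: H57 stays open (it is Edixhoven's case 1 re-typed), and so do
27662, 27552, C5, Manin's conjecture and BSD. No summit statement is proved by this seat.

References: [EdixhovenManin1991] §4; [Shimura1971] Prop. 3.64; [MazurTateTeitelbaum1986Invent] §I.8; crux dir
`Cruxes/ManinPrimeToAdditiveFiveLe/Lines/horocyclic-orientation.md`.
-/

set_option autoImplicit false
-- the Theorems namespace of this sub repeats the summit name by design (D-0017 nested layout)
set_option linter.dupNamespace false

noncomputable section

open scoped Classical NumberField

namespace Summit.BirchSwinnertonDyer.BirchSwinnertonDyer.Theorems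

/-! ## §5 K18b″ (stmt-27662) from horocyclic witnesses -/

section Corollary

open WeierstrassCurve IsDedekindDomain NumberField Literature.NumberTheory.EllipticCurves
  Literature.NumberTheory.EllipticCurves.ModularForms

/-- **`stub_notBottom_of_horocyclic57` of line «horocyclic-orientation»: `OrdinaryCornerDeepUnstarredHorocyclic →
OrdinaryCornerDeepUnstarredNotBottom` (K18b″, stmt-27662, BY NAME)**, with the line's crux spelled out verbatim
(on the rows `(5; v₅Δ = 3)`, `(7; v₇Δ ∈ {2, 4})`, `p² ∣ N`, `W[p]` reducible, `W ⊗ p*` additive, lattice-optimal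
datum, Serre–Tate-deep: some `A, C` with `N ∣ C > 0`, `gcd(A, C) = 1`, `p ∣ A² − 1` and
`Σ_{i≤k} (−1)^i C(k,i) {∞, A/C + i/p}_{f_W} ∉ p·Λ_{f_W}`). Immediate from `horocyclicDifference_mem_of_bottom`
(`p ∈ {5, 7}` is odd); every other binder is idle. [cite: EdixhovenManin1991, §4] [cite: Shimura1971, Prop. 3.64] -/
theorem ordinaryCornerDeepUnstarredNotBottom_of_horocyclicWitnesses
    (H : ∀ (W : WeierstrassCurve ℚ) [W.IsElliptic] [W.IsGloballyMinimal] (p : ℕ) [Fact p.Prime]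
      [NeZero (W.conductorNorm ℤ)] (D : ModularParametrizationData W (W.conductorNorm ℤ))
      (_hsq : p ^ 2 ∣ W.conductorNorm ℤ),
      ((p = 5 ∧ padicValInt 5 W.minimalDiscriminantInt = 3) ∨
        (p = 7 ∧ padicValInt 7 W.minimalDiscriminantInt ∈ ({2, 4} : Finset ℕ))) →
      ¬ W.HasIrreducibleModPGaloisRep p →
      ¬ ((W.quadraticTwist (((-1 : ℤ) ^ (p / 2) * p : ℤ) : ℚ)).HasGoodReductionAt
            ((Rat.HeightOneSpectrum.primesEquiv (R := ℤ)).symm ⟨p, Fact.out⟩) ∨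
         (W.quadraticTwist (((-1 : ℤ) ^ (p / 2) * p : ℤ) : ℚ)).HasMultiplicativeReductionAt
            ((Rat.HeightOneSpectrum.primesEquiv (R := ℤ)).symm ⟨p, Fact.out⟩)) →
      (∀ z ∈ D.L.lattice, ∃ w ∈ periodLattice D.f, z = D.c * w) →
      ((p = 5 → (3 : ℤ) ≤ padicValRat 5 (W.j - 1728)) ∧ (p = 7 → (4 : ℤ) ≤ padicValRat 7 W.j)) →
      ∃ (A C : ℤ), (W.conductorNorm ℤ : ℤ) ∣ C ∧ 0 < C ∧ IsCoprime A C ∧ (p : ℤ) ∣ A * A - 1 ∧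
        ¬ ∃ y ∈ periodLattice D.f, (∑ i ∈ Finset.range ((p - 1) / 2 + 1),
          ((((-1 : ℤ) ^ i * (((p - 1) / 2).choose i : ℕ)) : ℤ) : ℂ) *
            modularSymbol D.f ((A : ℚ) / (C : ℚ) + (i : ℚ) / (p : ℚ))) = (p : ℂ) * y) :
    Summit.BirchSwinnertonDyer.BirchSwinnertonDyer.Theses.TwistFamilyManinDescent.OrdinaryCornerDeepUnstarredNotBottom := by
  intro W _ _ p _ _ D hsq hrows hred hadd hopt hdeep χ hχ hprim hbot
  obtain ⟨A, C, hNC, hC0, hAC, hA, hnot⟩ := H W p D hsq hrows hred hadd hopt hdeep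
  have hp2 : p ≠ 2 := by
    rcases hrows with ⟨rfl, _⟩ | ⟨rfl, _⟩ <;> decide
  have hχL : ∀ u : ZMod p, χ u = ((quadraticChar (ZMod p) u : ℤ) : ℂ) := fun u ↦ by
    rw [dirichletCharacter_eq_quadraticChar_of_isQuadratic_of_isPrimitive hp2 χ hχ hprim,
      MulChar.ringHomComp_apply, eq_intCast]
  exact hnot (horocyclicDifference_mem_of_bottom D.f hp2 (dvd_refl _) hsq hχ hχL
    (gaussSum_stdAddChar_ne_zero_of_isPrimitive hprim) hbot A C hNC hC0.ne' hAC hA)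

end Corollary

end Summit.BirchSwinnertonDyer.BirchSwinnertonDyer.Theorems

end
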